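import Summits.QuantumFields.QCD.Theorems.WindowExtinction.Negative.SpectralFlow

/-!
# `WindowExtinction` (crux stmt-QuantumFields-8964) — negative-side support:
# clause (b) is triggered by ANY eigenvalue of `D_W(U,0,1)` near the bare-mass point (σ_min ≤ |λ + m₀|)

Standing crux disprover, cycle 2 (2026-08-16). Clause (b) of EXTINCT counts the eigenvalues of the
Hermitian Wilson–Dirac operator `H_W(m₀) = Γ₅ D_W(U, m₀, 1)` in `(−r, r)`, `m₀ = m_f(k) = m_crit(k) + a_k m_f/Z_k`,
`r = c · a_k m_f/Z_k` ("coercivity defects": `σ_min(D_W + m₀) < r`). Pathwise, for every gauge field and every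
unitary colour representation:

* `exists_abs_eigenvalue_lt` / `exists_root_abs_re_lt` (abstract): if a Hermitian matrix `A` has a test vector
  with `‖A v‖² < r² ‖v‖²` then `A` has an eigenvalue in `(−r, r)` (`‖Av‖² = Σ λ_i² |(U†v)_i|²`,
  `sum_norm_sq_mulVec_eq_sum_eigenvalues`).
* `coercivityDefect_of_near_root`: if the MASSLESS operator `D_W(U,0,1)` has a characteristic root `z` — real
  OR COMPLEX — with `‖z + m₀‖ < r`, then `H_W(m₀)` has an eigenvalue `e` with `|e| < r`
  (`H_W(m₀) v = (z + m₀) Γ₅ v` for the eigenvector `v`, `Γ₅` an isometry); in the crux's counting form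
  `one_le_countP_coercivityDefect_of_near_root`: the clause-(b) count at flavour `f` is `≥ 1` on every field whose
  massless spectrum meets the open disc of radius `c a_k m_f/Z_k` about the bare point
  `−m_f(k) = |m_crit(k)| − a_k m_f/Z_k`.

READING (the cone). As `m_f` ranges over `(M₀, ∞)` these discs sweep the truncated CONE
`{z : |z − (E_k − t)| < c t, t > a_k M₀/Z_k}`, `E_k = −m_crit(k)`, of half-opening `arcsin c` about the
leftward real ray from the witness's edge point `E_k` (cf. crux idea `singular-value-cone`). So EXTINCT(b) forces,
flavour by flavour and in phase-quenched mean, the WHOLE spectrum of `D_W(U,0,1)` — not only its real part — out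
of each such disc eventually: together with EXTINCT(a) (no real modes left of `E_k − a_k m_f/Z_k`) and TIGHT (an
accumulation of real modes in `[E_k − a_k m_f/Z_k, E_k + a_k M/Z_k]`, landed `window_realModes_ge`) the witness's
edge must be approached by the physical branch from OUTSIDE the cone, i.e. steeper than the angle `arcsin c`
(the continuum picture `E_k + i a_k λ_phys + O(a_k²)` is vertical, consistent for every `c < 1`; the witness's
`c` is exactly the sine of the admissible approach angle). The converse fails (triage r1-2 on
`singular-value-cone`: near-Krein-collision pairs give `σ_min ≈ δ²/(2|b|)` with no eigenvalue in the disc), so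
this is a one-sided, necessary condition — negative-side bookkeeping, not a route to EXTINCT(b).
-/

namespace Summit.QuantumFields.QCD.Theorems.WindowExtinction.Negative

open Matrix
open Literature.MathematicalPhysics.QuantumLattice Literature.MathematicalPhysics.QuantumFieldTheory
  Literature.Probability.LatticeModels
open Summit.QuantumFields.QCD.Theorems.ExtinctionBuildsQCD.Negative
open Summit.QuantumFields.QCD.Theorems.TiltedFlatnessNegative

noncomputable section

section Abstract

variable {n : Type*} [Fintype n] [DecidableEq n]

/-- **`‖A v‖²` in eigen-coordinates**: `Σ_j ‖(A v)_j‖² = Σ_i λ_i² ‖(U† v)_i‖²` for a Hermitian matrix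
`A = U diag(λ) U†` (Mathlib's `eigenvectorUnitary`). [folklore] -/
theorem sum_norm_sq_mulVec_eq_sum_eigenvalues {A : Matrix n n ℂ} (hA : A.IsHermitian) (v : n → ℂ) :
    ∑ j, ‖(A *ᵥ v) j‖ ^ 2 =
      ∑ i, hA.eigenvalues i ^ 2 * ‖((hA.eigenvectorUnitary : Matrix n n ℂ)ᴴ *ᵥ v) i‖ ^ 2 := by
  set U : Matrix n n ℂ := (hA.eigenvectorUnitary : Matrix n n ℂ) with hUdef
  have hof : (RCLike.ofReal ∘ hA.eigenvalues : n → ℂ) = fun i => ((hA.eigenvalues i : ℝ) : ℂ) := rfl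
  have hU : A = U * diagonal (fun i => ((hA.eigenvalues i : ℝ) : ℂ)) * Uᴴ := by
    have h := hA.spectral_theorem
    rw [Unitary.conjStarAlgAut_apply, star_eq_conjTranspose, hof] at h
    exact h
  have hiso : Uᴴ * U = 1 := by
    rw [hUdef, ← star_eq_conjTranspose]
    exact Unitary.coe_star_mul_self hA.eigenvectorUnitary
  have hAv : A *ᵥ v = U *ᵥ (diagonal (fun i => ((hA.eigenvalues i : ℝ) : ℂ)) *ᵥ (Uᴴ *ᵥ v)) := by
    conv_lhs => rw [hU, Matrix.mul_assoc]
    rw [← mulVec_mulVec, ← mulVec_mulVec]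
  rw [hAv, sum_norm_sq_mulVec_of_isometry hiso]
  refine Finset.sum_congr rfl fun i _ => ?_
  rw [mulVec_diagonal, norm_mul, mul_pow, Complex.norm_real, Real.norm_eq_abs, sq_abs]

/-- **A test vector below level `r` forces an eigenvalue in `(−r, r)`.** If `‖A v‖² < r² ‖v‖²` for a
Hermitian matrix `A`, some vector `v` and `r ≥ 0`, then `|λ_i(A)| < r` for some `i` (the smallest
`|eigenvalue|` of a Hermitian matrix is the minimum of `‖Av‖/‖v‖`). [folklore] -/
theorem exists_abs_eigenvalue_lt {A : Matrix n n ℂ} (hA : A.IsHermitian) {v : n → ℂ} {r : ℝ} (hr : 0 ≤ r)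
    (h : ∑ j, ‖(A *ᵥ v) j‖ ^ 2 < r ^ 2 * ∑ j, ‖v j‖ ^ 2) :
    ∃ i, |hA.eigenvalues i| < r := by
  by_contra hno
  push Not at hno
  rw [sum_norm_sq_mulVec_eq_sum_eigenvalues hA v,
    ← sum_norm_sq_eigenvectorUnitary_conjTranspose_mulVec hA v, Finset.mul_sum] at h
  refine absurd h (not_lt.2 (Finset.sum_le_sum fun i _ => ?_))
  have hsq : r ^ 2 ≤ hA.eigenvalues i ^ 2 := by
    rw [← sq_abs (hA.eigenvalues i)]
    exact pow_le_pow_left₀ hr (hno i) 2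
  exact mul_le_mul_of_nonneg_right hsq (by positivity)

/-- The same, as a characteristic root `z` with `|Re z| < r` (the roots of a Hermitian matrix are its real
eigenvalues). [folklore] -/
theorem exists_root_abs_re_lt {A : Matrix n n ℂ} (hA : A.IsHermitian) {v : n → ℂ} {r : ℝ} (hr : 0 ≤ r)
    (h : ∑ j, ‖(A *ᵥ v) j‖ ^ 2 < r ^ 2 * ∑ j, ‖v j‖ ^ 2) :
    ∃ z ∈ A.charpoly.roots, |z.re| < r := by
  obtain ⟨i, hi⟩ := exists_abs_eigenvalue_lt hA hr h
  refine ⟨((hA.eigenvalues i : ℝ) : ℂ), ?_, by simpa using hi⟩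
  rw [hA.roots_charpoly_eq_eigenvalues]
  exact Multiset.mem_map.2 ⟨i, by simp, rfl⟩

/-- A root of the characteristic polynomial of a complex matrix has an eigenvector. [folklore] -/
theorem exists_eigenvector_of_mem_roots_charpoly (A : Matrix n n ℂ) {z : ℂ} (hz : z ∈ A.charpoly.roots) :
    ∃ v : n → ℂ, v ≠ 0 ∧ A *ᵥ v = z • v := by
  have hroot : A.charpoly.IsRoot z := (Polynomial.mem_roots A.charpoly_monic.ne_zero).1 hz
  have hspec : z ∈ spectrum ℂ A := Matrix.mem_spectrum_iff_isRoot_charpoly.2 hroot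
  rw [spectrum.mem_iff, Matrix.isUnit_iff_isUnit_det, isUnit_iff_ne_zero, not_not] at hspec
  obtain ⟨v, hv, hv0⟩ := Matrix.exists_mulVec_eq_zero_iff.2 hspec
  refine ⟨v, hv, ?_⟩
  rw [Algebra.algebraMap_eq_smul_one, Matrix.sub_mulVec, Matrix.smul_mulVec, Matrix.one_mulVec,
    sub_eq_zero] at hv0
  exact hv0.symm

omit [DecidableEq n] in
/-- `Σ_i ‖(c • v) i‖² = ‖c‖² Σ_i ‖v i‖²`. [folklore] -/
theorem sum_norm_sq_smul (c : ℂ) (v : n → ℂ) :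
    ∑ i, ‖(c • v) i‖ ^ 2 = ‖c‖ ^ 2 * ∑ i, ‖v i‖ ^ 2 := by
  rw [Finset.mul_sum]
  refine Finset.sum_congr rfl fun i _ => ?_
  rw [Pi.smul_apply, smul_eq_mul, norm_mul, mul_pow]

end Abstract

section Wilson

variable {L N : ℕ} [NeZero L] {G : Type*} [Group G] (ρ : G →* Matrix (Fin N) (Fin N) ℂ)

omit [NeZero L] in
/-- The bare mass enters `D_W` additively: `D_W(U,m,1) = D_W(U,0,1) + m·1`. [folklore] -/
theorem wilsonDirac_eq_add_mass (hρ : ∀ g, ρ g ∈ Matrix.unitaryGroup (Fin N) ℂ)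
    (U : GaugeConfig 4 L G) (m : ℝ) :
    wilsonDirac ρ U m 1 = wilsonDirac ρ U 0 1 + (m : ℂ) • (1 : Matrix _ _ ℂ) := by
  rw [wilsonDirac_eq_sub_sum_wilsonHop ρ hρ U m, wilsonDirac_eq_sub_sum_wilsonHop ρ hρ U 0,
    sub_add_eq_add_sub, ← add_smul, ← Complex.ofReal_add, zero_add, add_comm 4 m]

/-- **Clause (b) is triggered by any eigenvalue of the massless operator near the bare point.** If
`D_W(U,0,1)` has a characteristic root `z` (real or complex) with `‖z + m₀‖ < r`, then the Hermitian
Wilson–Dirac operator `H_W(m₀) = Γ₅ D_W(U,m₀,1)` has an eigenvalue `e` with `|e| < r`: for the eigenvector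
`v`, `H_W(m₀) v = (z + m₀) Γ₅ v` and `Γ₅` is an isometry, so `‖H_W(m₀) v‖ = |z + m₀| ‖v‖ < r ‖v‖`
(`σ_min(D_W + m₀) ≤ dist(−m₀, spec D_W(U,0,1))`). [folklore] -/
theorem coercivityDefect_of_near_root (hρ : ∀ g, ρ g ∈ Matrix.unitaryGroup (Fin N) ℂ)
    (U : GaugeConfig 4 L G) (m₀ : ℝ) {z : ℂ} (hz : z ∈ (wilsonDirac ρ U 0 1).charpoly.roots) {r : ℝ}
    (hr : ‖z + m₀‖ < r) :
    ∃ e ∈ (spinorLift gammaFive * wilsonDirac ρ U m₀ 1).charpoly.roots, |e.re| < r := by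
  obtain ⟨v, hv, hDv⟩ := exists_eigenvector_of_mem_roots_charpoly _ hz
  have hH : (spinorLift gammaFive * wilsonDirac ρ U m₀ 1).IsHermitian :=
    Literature.Barriers.QuantumFields.WilsonDeterminant.isHermitian_hermitianWilsonDirac ρ hρ U m₀ 1
  have hr0 : 0 ≤ r := (norm_nonneg _).trans hr.le
  refine exists_root_abs_re_lt hH hr0 (v := v) ?_
  have hDm : wilsonDirac ρ U m₀ 1 *ᵥ v = (z + m₀) • v := by
    rw [wilsonDirac_eq_add_mass ρ hρ U m₀, add_mulVec, smul_mulVec, one_mulVec, hDv, add_smul]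
  have hHv : (spinorLift gammaFive * wilsonDirac ρ U m₀ 1) *ᵥ v =
      (z + m₀) • ((spinorLift gammaFive : Matrix _ _ ℂ) *ᵥ v) := by
    rw [← mulVec_mulVec, hDm, mulVec_smul]
  have hΓ : (spinorLift gammaFive : Matrix (TorusSite 4 L × Fin N × Fin 4) _ ℂ)ᴴ *
      spinorLift gammaFive = 1 := by
    rw [Literature.Barriers.QuantumFields.WilsonDeterminant.conjTranspose_spinorLift_gammaFive,
      spinorLift_gammaFive_mul_self]
  rw [hHv, sum_norm_sq_smul, sum_norm_sq_mulVec_of_isometry hΓ]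
  have hsq : ‖z + m₀‖ ^ 2 < r ^ 2 := pow_lt_pow_left₀ hr (norm_nonneg _) two_ne_zero
  exact mul_lt_mul_of_pos_right hsq (sum_norm_sq_pos hv)

/-- **Counting form** (the crux's clause (b) with `m₀ = m_crit(k) + a_k m_f/Z_k`, `r = c a_k m_f/Z_k`): the
number of characteristic roots `e` of `Γ₅ D_W(U,m₀,1)` with `|Re e| < r` is `≥ 1` on every gauge field whose
MASSLESS Wilson–Dirac spectrum meets the open disc `{z : ‖z + m₀‖ < r}`. [folklore] -/
theorem one_le_countP_coercivityDefect_of_near_root (hρ : ∀ g, ρ g ∈ Matrix.unitaryGroup (Fin N) ℂ)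
    (U : GaugeConfig 4 L G) (m₀ : ℝ) {z : ℂ} (hz : z ∈ (wilsonDirac ρ U 0 1).charpoly.roots) {r : ℝ}
    (hr : ‖z + m₀‖ < r) :
    1 ≤ (spinorLift gammaFive * wilsonDirac ρ U m₀ 1).charpoly.roots.countP fun e : ℂ => |e.re| < r := by
  obtain ⟨e, he, her⟩ := coercivityDefect_of_near_root ρ hρ U m₀ hz hr
  exact Multiset.countP_pos.2 ⟨e, he, her⟩

/-- **The cone, one disc at a time** (pure bookkeeping for the READING in the module docstring): a point
`z` of the plane lies in the clause-(b) disc of the flavour with renormalised mass `m_f` iff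
`‖z + (m_crit + w)‖ < c w`, `w = a_k m_f/Z_k`; for `z` on the real axis to the LEFT of the edge,
`z = −m_crit − t` with `t > 0`, this holds for `w = t`, and `c < 1` is needed for the edge point itself
(`t = 0`) to stay outside every disc. Recorded as the elementary fact: the real point `−m_crit − w` is the
centre of the disc of parameter `w`. [folklore] -/
theorem real_point_mem_disc (mcrit w c : ℝ) (hc : 0 < c) (hw : 0 < w) :
    ‖((-mcrit - w : ℝ) : ℂ) + ((mcrit + w : ℝ) : ℂ)‖ < c * w := by
  rw [← Complex.ofReal_add, show -mcrit - w + (mcrit + w) = 0 by ring, Complex.ofReal_zero, norm_zero]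
  exact mul_pos hc hw

end Wilson

end

end Summit.QuantumFields.QCD.Theorems.WindowExtinction.Negative
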